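import Literature.MathematicalPhysics.QuantumFieldTheory.Balaban1983to89.B9Cor36CubeTwinsGeometry
import Literature.MathematicalPhysics.QuantumFieldTheory.Balaban1983to89.B9Cor36GpCubeLocAtMember
import Literature.MathematicalPhysics.QuantumFieldTheory.Balaban1983to89.B6Line3GapV1
import Literature.MathematicalPhysics.QuantumFieldTheory.Balaban1983to89.B6TorusDepthDistance

/-!
# `Balaban1983to89.B9ThmDCubePlateau` — THEOREM D FOR THE RECORD'S LETTERS, FILE D2: THE PLATEAU CUT-OFF IS `χ_□` ITSELF — the geometry of its
# rows (the window `NearC 4S_j`, the row set `D_χ`, `□̃ ⊂ NearC 2S_j`), the configuration agreement of `U^u` and `Ṽ_□` out to `3.75S_j`, and the two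
# ROW LAWS of file D1 (`Δ′_a(U^u)M_χ = Δ′_{a,□}(Ṽ_□)M_χ`, `M_χΔ′_{a,□}(Ṽ_□) − Δ′_{a,□}(Ṽ_□)M_χ = K(χ_□)(Ṽ_□)`) DISCHARGED at the (3.35) datum
# (sub-row G-B9-LETTERS, GAPS G-B9-05, file D2)

T. Bałaban, *Propagators for lattice gauge theories in a background field*, Commun. Math. Phys. **99** (1985) 389–434 [`Balaban1985BackgroundPropagators`, "[B9]"];
[2] = T. Bałaban, *Regularity and decay of lattice Green's functions*, Commun. Math. Phys. **89** (1983) 571–597 [`Balaban1983RegularityDecay`] (Sect. 5 Thm (5.8)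
p. 594); [4] = T. Bałaban, *Propagators and renormalization transformations for lattice gauge theories. II*, Commun. Math. Phys. **96** (1984) 223–250
[`Balaban1984PropagatorsII`].

statement-level skeleton of published theorems with citation tags; proofs where landed; nothing here is a claim about the Yang–Mills mass gap

THE PRINT (held `paper:balaban1985-cmp99-background-propagators`, journal page = PDF page + 388).  p. 412 (3.97): *«the operators may differ outside □̃₀, and the distance
from □̃ to □̃₀ᶜ is at least M (on L⁻ʲ-scale)»*; p. 410 l. 14–15: *«G′_□ depends on U restricted to Ω₀(□) ⊂ □̃⁵»*; p. 408 l. 36–44 (the sequence `{Ω_n(□)}`: the member's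
levels on `□̃³`, decreasing outward to `□̃⁵`); Cor. 3.6 p. 408 l. 3–6 («U′ = U^u = e^{iηA}»); (3.88) p. 409 (the stencil of `K(h)`); [4] p. 239 («ζ_□ ∈ C₀^∞(□̃)», the
reach `7S/4` of `□̃`), (2.2) p. 224.

WHY THIS FILE (cell `lit-balaban`, GAPS G-B9-05, seat p21 g35; design `lit-balaban-p21/THEOREM-D-DESIGN-p21.md`).  File D1 (`B9ThmDLocDiffAlgebra`) reduced M5.6's binder `hD`
to three products under two ROW LAWS of a plateau cut-off `φ` and four plateau relations.  THE CHOICE OF RECORD: `φ := χ_□` (p33's inner cut-off `chiY i □`, radius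
`4S_j`: `= 1` on `NearC 3S_j`, `= 0` off `NearC 3.5S_j`), because everything the (3.89) mechanism needs of `φ` is ALREADY in the tree for `χ_□` — first differences
(`B9Cor36CubeCutoffs.abs_chi_shiftY_sub_le`), second differences through the antipode (`B9Cor36CutoffSecondDiff.abs_chiY_second_diff_le`), the window `NearC 4S_j ⊂ NearH`
(`nearH_of_nearC'`) and the bond agreement `U^u = Ṽ_□` out to `min(3.75, 4.375)S_j` (`B9Cor36GpCubeLocAtMember.UboxY_gaugeY_eq_locCfgY`).  What this file adds is the
geometry of the ROWS of `Δ′_a` that the cut-off reaches — they lie within `3.5S_j + L^{j+1}`, their averaging runs within `3.5S_j + 2L^{j+1} ≤ 3.75S_j` (exactly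
`8L^{j+1} ≤ S_j`, i.e. `M_h ≥ 8`, the member's `hM8`) — and the torus-side reach of `□̃`: every site of a block of `QbigT □` is within `2S_j` of the centre of `β`
(the chart bound `7S/4 + S/16` of `B6Line3GapV1.abs_sub_ctr_le_of_mem_Qbig` read through the canonical chart), so `χ_□ = 1` on `□̃ ⊇ □⁺` — the plateau relations.

CITATION HEADER (lean-in-tree rule).  REUSED BY NAME: p33 `B9Cor36CubeCutoffs` (`SC`, `NearC`, `chiY`, `chiTY`, `locCfgY`, windows), `B9Cor36CutoffSecondDiff.nearH_of_nearC'`,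
`B9Cor36GpCubeLocAtMember.UboxY_gaugeY_eq_locCfgY`, `B9Cor36GpCubeLocLetter` (§1 stencil lemmas, `deltaPrimeACubeY_apply_eq_zero_of_stencil`); r05 `B9CubeLettersOpsL0`
(`deltaPrimeACubeY_apply_eq_of_nearH`, `levCubeY_eq_levY_of_nearH`, `lev_cubeFam_le_succ`), `B9CubeSequence408`; p21 `B9Cor36CubeTwinsGeometry` (`bS`, `eight_mul_bS_le_SC`,
`sub_le_dist_mul_of_nearC`), `B6Line3GapV1.abs_sub_ctr_le_of_mem_Qbig`, `B6TorusDepthDistance.blkOf_eq_blkMap_symm`, `B6Partition118KLevelTorusCentral` (`QbigT`, `Dch`, `cc`,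
`ctr_cc_bounds`); def-Y `Node00.OpsYLocalInverseAgree` (`AgreeNearY`, `deltaPrimeAY_apply_congr_of_parLocalY`, `parLocalY_parSymY`); p38 `B9Thm37CubeCoverCommutators`
(`KhY`, `stencilY`, `deltaPrimeAY_mul_cutMulY`).  No existing module is modified.

WHAT THIS FILE PROVES (THEOREMS only; 0 `def … : Prop`; one `Finset` def `Dchi`; 0 sorry; standard axioms).
* §1 ★ `nearC_of_mem_QbigT` — every site of a block of `□̃ = QbigT □` is within `2S_j` of the centre of `β` (torus distance, every coordinate); `chiY_eq_one_of_mem_QbigT`,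
  `chiY_eq_one_of_mem_QT`.
* §2 the wide window: `levY_le_succ_of_nearC'` (`r ≤ 4S_j`), `pow_levY_le_bS'`, `nearC_of_mem_stencilY_rev'`; the row set `Dchi` of the rows whose stencil meets `supp χ_□`,
  `nearC_of_mem_Dchi` (`⊂ NearC(3.5S_j + L^{j+1})`), `nearH_of_mem_Dchi`, `chiY_eq_zero_of_not_mem_Dchi`.
* §3 agreement: ★ `agreeNearY_of_nearC'` (bond agreement within `3.75S_j` ⟹ `AgreeNearY` on any row set within `3.5S_j + L^{j+1}`), ★ `agreeNearY_locCfgY_of_nearC'` (from the datum).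
* §4 ★★ THE ROW LAWS OF FILE D1 AT THE DATUM (`parS := parSymY`, `φ := χ := chiY i □`, `Ṽ_□ = locCfgY i □ η A`): `deltaPrimeAY_gauge_mul_cutMulY_chiY`
  (`Δ′_a(U^u)M_χ = Δ′_{a,□}(Ṽ_□)M_χ`), `comm_cutMulY_chiY_deltaPrimeACubeY` (`M_χΔ′_{a,□}(Ṽ_□) − Δ′_{a,□}(Ṽ_□)M_χ = K(χ)(Ṽ_□)`), and the plateau relations
  `chiBigT_site_mul_chiY`, `chiY_mul_cubeIndT_site` (`χ̃_□·χ = χ̃_□`, `χ·1_{□⁺} = 1_{□⁺}` on sites).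

HONEST SCOPE.  Geometry and bookkeeping of the cut-off rows; no estimate.  `M_h ≥ 8`, `L ≥ 5`, `R ≥ 2L²` are the member's (`KIdx`).  Count-neutral; nothing continuum,
nothing about OS axioms or the mass gap.  No `sorry`, no `axiom`, no `instance`, no `notation`.  NEW file.  Net new unproved facts: 0.  Seat `lit-balaban-p21` gen 35,
2026-08-28; `--supports stmt-QuantumFields-19200`.
-/

noncomputable section

namespace Literature.MathematicalPhysics.QuantumFieldTheory.Balaban1983to89.B9ThmDCubePlateau

open B6KLevelCensusIndexV1 (KIdx kGeo)
open B6Cover236MultiLevelBlocks (cubes)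
open B6Cover236MultiLevelTorusBlocks (cubeIndT)
open B6Geom246MultiLevelBox (bset blkOf toR)
open B6Geom246MultiLevelTorus (blkMap blkMap_injective)
open B6Partition118KLevelTorusCentral (QT QbigT QT_subset_QbigT Dch cc side_cc one_le_of_four_le)
open B6MultiLevelBoxOperator (bigSide)
open B6MultiLevelTorusOperator (one_le_of_mem tshift tshift_val_eq_translate)
open B4TorusKernel.MultiPeriod (circAbs circAbs_le_abs circAbs_nonneg circAbs_add_mul)
open B9CubeSequence408 (NearH sI hf ctrC two_mul_hf_add_one)
open B9CubeLettersOpsL0 (cubeFamY oddMh two_le_R levCubeY deltaPrimeACubeY deltaPrimeACubeY_apply_eq_of_nearH levCubeY_eq_levY_of_nearH)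
open B9CubeSequence408 (lev_cubeFam_le_succ)
open B9Cor36CubeTwinsGeometry (bS one_le_bS eight_mul_bS_le_SC)
open B9Thm37CubeCoverCommutators (cutMulY cutMulY_apply cutMulY_mul stencilY KhY deltaPrimeAY_mul_cutMulY)
open B9Thm37CubeCoverCommutatorSizes (side_conditions four_le_P')
open B9Thm39CinvAtCover (chiBigT)
open B9Cor36CubeCutoffs (SC NearC nearH_of_nearC levY_le_succ_of_nearC chiY chiY_eq_one_of_nearC one_le_SC nine_le_SC nearC_of_chiY_ne_zero
  nearC_shiftY nearC_shiftY_symm nearC_of_blkOf_eq levY_eq_of_blkOf_eq abs_sub_le_of_blkOf_eq chiTY chiTY_eq_one_of_nearC locCfgY locCfgY_apply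
  fluct_cutFldY_of_eq_one)
open B9Cor36CutoffSecondDiff (nearH_of_nearC')
open B9Cor36GpCubeLocLetter (deltaPrimeAY_apply_eq_zero_of_stencil deltaPrimeACubeY_apply_eq_zero_of_stencil)
open B9GeoLemma21KLevelV1 (one_le_Mh)
open Node00 (SiteY BlkY CfgY GaugeY toKT levY parSymY gaugeY UboxY shiftY avgCoeffY deltaPrimeAY)
open Node00.OpsYLocalInverseAgree (AgreeNearY taxiBondsY parLocalY_parSymY deltaPrimeAY_apply_congr_of_parLocalY)

variable {d ℓ : ℕ} {hd : 1 ≤ d + 1} {hL : Odd (ℓ + 1) ∧ 1 < ℓ + 1} {b₀ b₁ : ℝ}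
variable (i : KIdx d ℓ hd hL b₀ b₁) (c : ↥(cubes (toKT i).D.toDomains))

/-! ## §1 The torus-side reach of `□̃`: every site of a block of `QbigT □` is within `2S_j` of the centre of `β` -/

/-- ★ **`□̃ ⊂ NearC 2S_j` ON THE TORUS**: a site `z` of a member block in `QbigT □` has every coordinate within torus distance `2S_j` of the centre of `β`
(chart side: `|x_μ − ctr_μ| ≤ 7S/4 + S/16` for the sites of `□̃`, [4] p. 239; read through the canonical chart of `□`, whose centre is `ctr(β) + ½` modulo the period).
[cite: Balaban1984PropagatorsII, p.239 («ζ_□ ∈ C₀^∞(□̃)»), p.235, (2.2) p.224; Balaban1985BackgroundPropagators, (3.95) p.411 («□̃»)] -/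
theorem nearC_of_mem_QbigT {t : BlkY i} (ht : t ∈ QbigT i.D (one_le_Mh i) (four_le_P' i) c) {z : SiteY i} (hz : blkOf i.D.toDomains z = t) :
    NearC i c (2 * SC i c) z.1 := by
  have hP : ∀ μ, 1 ≤ (toKT i).P μ := fun μ => le_trans (by norm_num) (four_le_P' i μ)
  -- the chart block of `z`
  obtain ⟨bq, hbq, hbt⟩ := Finset.mem_image.1 ht
  set w : SiteY i := (tshift (toKT i).NB (B6MultiLevelTorusOperator.TDomains.tvec ℓ i.Mh i.k (B6Eq238MultiLevelTorus.svec ℓ i.k c.1.1 c.1.2))).symm z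
    with hw
  have hzb : blkOf i.D.toDomains z = blkMap i.D (B6Eq238MultiLevelTorus.svec ℓ i.k c.1.1 c.1.2) (blkOf (Dch i.D c) w) :=
    B6TorusDepthDistance.blkOf_eq_blkMap_symm (D := i.D) (one_le_Mh i) hP _ z
  have hwb : blkOf (Dch i.D c) w = bq := by
    apply blkMap_injective (D := i.D) (one_le_Mh i) hP (B6Eq238MultiLevelTorus.svec ℓ i.k c.1.1 c.1.2)
    rw [← hzb, hz, hbt]
  -- the chart bound `|w_μ − (qc_μ + ½)S| ≤ 7S/4 + S/16`
  intro μ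
  have hR3 : 3 * (ℓ + 1) ≤ i.R := by
    have h := i.hR2; have hl : 1 ≤ ℓ + 1 := by omega
    nlinarith
  have hch := B6Line3GapV1.abs_sub_ctr_le_of_mem_Qbig (Dch i.D c) i.hM8 hR3 hbq hwb μ
  rw [side_cc] at hch
  -- coordinates: `z = w + S_k·s (mod N)`, `ctr(β) = qc·S + hf + S_k·s`
  obtain ⟨m, hm⟩ := tshift_val_eq_translate (toKT i).NB (B6MultiLevelTorusOperator.TDomains.tvec ℓ i.Mh i.k (B6Eq238MultiLevelTorus.svec ℓ i.k c.1.1 c.1.2)) w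
  have hzw : z = tshift (toKT i).NB (B6MultiLevelTorusOperator.TDomains.tvec ℓ i.Mh i.k (B6Eq238MultiLevelTorus.svec ℓ i.k c.1.1 c.1.2)) w := by
    rw [hw, Equiv.apply_symm_apply]
  have hN : 1 ≤ (toKT i).NB μ := one_le_of_mem z.2 μ
  have hjk : c.1.1 ≤ i.k := (B6Partition118KLevelTorusCentral.level_bounds i.D.toDomains c).2
  have eSk : (bigSide ℓ i.Mh i.k : ℤ) = (bigSide ℓ i.Mh c.1.1 : ℤ) * (B6Eq238MultiLevelTorus.rj ℓ i.k c.1.1 : ℤ) := by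
    rw [B6Eq238MultiLevelTorus.bigSide_k_eq (ℓ := ℓ) (Mh := i.Mh) hjk, B6MultiLevelBoxOperator.bigSide_eq]; push_cast; ring
  have hq := B6Eq238MultiLevelTorus.q_eq_qc_add (ℓ := ℓ) (k := i.k) c.1.1 c.1.2 μ
  have eS : SC i c = (bigSide ℓ i.Mh c.1.1 : ℤ) := rfl
  have e1 : 2 * hf ℓ i.Mh c.1.1 + 1 = (bigSide ℓ i.Mh c.1.1 : ℤ) := two_mul_hf_add_one hL.1 (oddMh i) c.1.1
  -- the integer `v = w_μ − qc_μ·S − hf` with `z_μ − ctr_μ = v + N·m`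
  have hcoord : z.1 μ - ctrC c μ = (w.1 μ - B6Eq238MultiLevelTorus.qc ℓ i.k c.1.1 c.1.2 μ * (bigSide ℓ i.Mh c.1.1 : ℤ) - hf ℓ i.Mh c.1.1) +
      (toKT i).NB μ * m μ := by
    have hzμ : z.1 μ = w.1 μ + (bigSide ℓ i.Mh i.k : ℤ) * B6Eq238MultiLevelTorus.svec ℓ i.k c.1.1 c.1.2 μ + (toKT i).NB μ * m μ := by
      rw [hzw, hm]; simp only [B4TorusKernel.MultiPeriod.translate, Pi.add_apply, B6MultiLevelTorusOperator.TDomains.tvec]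
    rw [hzμ]
    show w.1 μ + (bigSide ℓ i.Mh i.k : ℤ) * B6Eq238MultiLevelTorus.svec ℓ i.k c.1.1 c.1.2 μ + (toKT i).NB μ * m μ -
        (c.1.2 μ * (bigSide ℓ i.Mh c.1.1 : ℤ) + hf ℓ i.Mh c.1.1) = _
    rw [hq, eSk]; ring
  rw [hcoord, circAbs_add_mul]
  refine (circAbs_le_abs hN _).trans ?_
  rw [eS]
  -- real arithmetic: `|v| ≤ 29S/16 + ½ ≤ 2S`
  have hS9 : (9 : ℝ) ≤ (bigSide ℓ i.Mh c.1.1 : ℝ) := by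
    have h := nine_le_SC i c; rw [eS] at h; exact_mod_cast h
  have ehf : ((hf ℓ i.Mh c.1.1 : ℤ) : ℝ) = ((bigSide ℓ i.Mh c.1.1 : ℝ) - 1) / 2 := by
    have e : (2 : ℝ) * ((hf ℓ i.Mh c.1.1 : ℤ) : ℝ) + 1 = (bigSide ℓ i.Mh c.1.1 : ℝ) := by exact_mod_cast e1
    linarith
  have h2 : |((w.1 μ : ℤ) : ℝ) - (((B6Eq238MultiLevelTorus.qc ℓ i.k c.1.1 c.1.2 μ : ℤ) : ℝ) + 1 / 2) * (bigSide ℓ i.Mh c.1.1 : ℝ)| ≤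
      7 / 4 * (bigSide ℓ i.Mh c.1.1 : ℝ) + (bigSide ℓ i.Mh c.1.1 : ℝ) / 16 := hch
  have key : ((|w.1 μ - B6Eq238MultiLevelTorus.qc ℓ i.k c.1.1 c.1.2 μ * (bigSide ℓ i.Mh c.1.1 : ℤ) - hf ℓ i.Mh c.1.1| : ℤ) : ℝ) ≤
      ((2 * (bigSide ℓ i.Mh c.1.1 : ℤ) : ℤ) : ℝ) := by
    push_cast
    rw [ehf]
    rw [abs_le] at h2 ⊢
    constructor <;> linarith [h2.1, h2.2]
  exact_mod_cast key

/-- `χ_□ = 1` on every site of `□̃`. [cite: Balaban1985BackgroundPropagators, (3.95) p.411, Cor. 3.6 p.408; Balaban1984PropagatorsI, (1.118) p.36] -/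
theorem chiY_eq_one_of_mem_QbigT {t : BlkY i} (ht : t ∈ QbigT i.D (one_le_Mh i) (four_le_P' i) c) {z : SiteY i} (hz : blkOf i.D.toDomains z = t) :
    chiY i c z = 1 :=
  chiY_eq_one_of_nearC i c (by linarith [one_le_SC i c]) (nearC_of_mem_QbigT i c ht hz)

/-- `χ_□ = 1` on every site of `□⁺ ⊂ □̃`. [cite: Balaban1985BackgroundPropagators, (3.95) p.411; Balaban1984PropagatorsII, p.239] -/
theorem chiY_eq_one_of_mem_QT {t : BlkY i} (ht : t ∈ QT i.D (one_le_Mh i) (four_le_P' i) c) {z : SiteY i} (hz : blkOf i.D.toDomains z = t) :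
    chiY i c z = 1 :=
  chiY_eq_one_of_mem_QbigT i c (QT_subset_QbigT (D := i.D) (one_le_Mh i) (four_le_P' i) c ht) hz

/-! ## §2 The wide window `NearC 4S_j`: levels, the reverse stencil step, and the row set `D_χ` of the cut-off `χ_□` -/

/-- near □ out to `4S_j` the member's level is at most `j + 1` (p33's window `NearC 4S_j ⊂ NearH`, r05's coarsening).
[cite: Balaban1985BackgroundPropagators, p.408 (the sequence {Ω_n(□)}); Balaban1984PropagatorsII, (2.2) p.224] -/
theorem levY_le_succ_of_nearC' {r : ℤ} (hr : r ≤ 4 * SC i c) {z : SiteY i} (hz : NearC i c r z.1) : levY i z ≤ c.1.1 + 1 := by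
  rw [← levCubeY_eq_levY_of_nearH i c (nearH_of_nearC' i c hr hz)]
  exact lev_cubeFam_le_succ z.1

/-- hence its block side is at most `L^{j+1}`. [cite: Balaban1984PropagatorsII, (2.1) p.224, bookkeeping] -/
theorem pow_levY_le_bS' {r : ℤ} (hr : r ≤ 4 * SC i c) {z : SiteY i} (hz : NearC i c r z.1) : (((ℓ + 1) ^ levY i z : ℕ) : ℤ) ≤ (bS i c : ℤ) := by
  exact_mod_cast Nat.pow_le_pow_right (by omega) (levY_le_succ_of_nearC' i c hr hz)

/-- ★ the reverse stencil step out to `4S_j`: if `w ∈ stencil(z)` is within `r ≤ 4S_j` then `z` is within `r + L^{j+1}` (neighbours `+1`, block-mates `+(L^{lev} − 1)`,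
levels `≤ j + 1` in the wide window). [cite: Balaban1985BackgroundPropagators, (3.88) p.409 (the stencil of K(h)), p.408] -/
theorem nearC_of_mem_stencilY_rev' {r : ℤ} (hr : r ≤ 4 * SC i c) {z w : SiteY i} (hw : NearC i c r w.1) (hmem : w ∈ stencilY i z) :
    NearC i c (r + (bS i c : ℤ)) z.1 := by
  have hb := one_le_bS i c
  have hb' : (1 : ℤ) ≤ (bS i c : ℤ) := by exact_mod_cast hb
  unfold stencilY at hmem
  simp only [Finset.mem_union, Finset.mem_singleton, Finset.mem_image, Finset.mem_univ, true_and, Finset.mem_filter] at hmem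
  rcases hmem with ((rfl | ⟨μ, rfl⟩) | ⟨μ, rfl⟩) | hmem
  · exact hw.mono i c (by linarith)
  · have h := nearC_shiftY_symm i c hw μ
    rw [Equiv.symm_apply_apply] at h
    exact h.mono i c (by linarith)
  · have h := nearC_shiftY i c hw μ
    rw [Equiv.apply_symm_apply] at h
    exact h.mono i c (by linarith)
  · have hbl : blkOf (toKT i).D.toDomains w = blkOf (toKT i).D.toDomains z := by
      rw [B9Thm311DeltaPrimeSymm.avgCoeffY_eq_ite] at hmem
      by_contra hne; exact hmem (if_neg hne)
    have h1 := nearC_of_blkOf_eq i c hbl hw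
    have hp := pow_levY_le_bS' i c hr hw
    rw [levY_eq_of_blkOf_eq i hbl] at hp
    exact h1.mono i c (by linarith)

open Classical in
/-- **`D_χ`**: the rows of `Δ′_a` whose stencil meets `supp χ_□` (the only rows on which `Δ′(χΛ)` can be non-zero).
[cite: Balaban1985BackgroundPropagators, (3.88) p.409, Cor. 3.6 p.408] -/
def Dchi : Finset (SiteY i) := Finset.univ.filter fun z => ∃ w ∈ stencilY i z, chiY i c w ≠ 0

/-- membership in `D_χ`. [cite: Balaban1985BackgroundPropagators, (3.88) p.409, bookkeeping] -/
theorem mem_Dchi {z w : SiteY i} (hw : w ∈ stencilY i z) (h : chiY i c w ≠ 0) : z ∈ Dchi i c := by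
  classical
  unfold Dchi
  simp only [Finset.mem_filter, Finset.mem_univ, true_and]
  exact ⟨w, hw, h⟩

/-- off `D_χ` the cut-off vanishes on the whole stencil. [cite: Balaban1985BackgroundPropagators, (3.88) p.409, bookkeeping] -/
theorem chiY_eq_zero_of_not_mem_Dchi {z : SiteY i} (hz : z ∉ Dchi i c) : ∀ w ∈ stencilY i z, chiY i c w = 0 := by
  intro w hw
  by_contra h
  exact hz (mem_Dchi i c hw h)

/-- ★ **THE ROWS OF `D_χ` ARE WITHIN `3.5S_j + L^{j+1}` OF THE CENTRE OF `β`** (`supp χ_□ ⊂ NearC 3.5S_j`, one reverse stencil step).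
[cite: Balaban1985BackgroundPropagators, (3.88) p.409, Cor. 3.6 p.408; Balaban1984PropagatorsI, (1.118) p.36] -/
theorem nearC_of_mem_Dchi {z : SiteY i} (hz : z ∈ Dchi i c) : NearC i c (7 * SC i c / 2 + (bS i c : ℤ)) z.1 := by
  classical
  unfold Dchi at hz
  simp only [Finset.mem_filter, Finset.mem_univ, true_and] at hz
  obtain ⟨w, hw, h⟩ := hz
  have hS := one_le_SC i c
  exact nearC_of_mem_stencilY_rev' i c (by omega) (nearC_of_chiY_ne_zero i c h) hw

/-- every row of `D_χ` is near □ (`3.5S_j + L^{j+1} ≤ 4S_j`). [cite: Balaban1985BackgroundPropagators, p.408 (□³ ⊂ Ω_j(□)), (3.88) p.409] -/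
theorem nearH_of_mem_Dchi {z : SiteY i} (hz : z ∈ Dchi i c) : NearH c z.1 := by
  have h8 := eight_mul_bS_le_SC i c
  exact nearH_of_nearC' i c (by omega) (nearC_of_mem_Dchi i c hz)

/-! ## §3 The configuration agreement of `U^u` and `Ṽ_□` on row sets out to `3.5S_j + L^{j+1}` -/

section Agreement

variable {𝔸 : Type} [NormedRing 𝔸] [NormedAlgebra ℂ 𝔸] [CompleteSpace 𝔸]

/-- ★ **BOND AGREEMENT WITHIN `R + L^{j+1}` IMPLIES `AgreeNearY` ON ANY ROW SET WITHIN `R ≤ 4S_j`** (p21's `agreeNearY_of_nearC` with the wide window): the bonds at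
`z`, `z − e_μ` (within `R + 1`) and the rungs of the taxi runs inside the member block of `z` (level `≤ j + 1`, so within `R + L^{j+1} − 1`) are agreement points.
[cite: Balaban1985BackgroundPropagators, p.410 l.14–15 («G′_□ depends on U restricted to Ω₀(□) ⊂ □̃⁵»), (3.40) p.397, (3.19) p.393] -/
theorem agreeNearY_of_nearC' {W V : CfgY 𝔸 i} {R : ℤ} (hR : R ≤ 4 * SC i c)
    (hWV : ∀ (κ : Fin (d + 1)) (x : Site (B6GlobalChartV1.PV d ℓ i.m i.K hd hL) 0), NearC i c (R + (bS i c : ℤ)) (B6GlobalChartV1.boxEquiv i.hN x).1 →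
      W κ x = V κ x)
    {D : Finset (SiteY i)} (hD : ∀ z ∈ D, NearC i c R z.1) :
    AgreeNearY i D W V := by
  have hb' : (1 : ℤ) ≤ (bS i c : ℤ) := by exact_mod_cast one_le_bS i c
  -- a torus point charting to within `r ≤ R + L^{j+1}` is an agreement point
  have key : ∀ (κ : Fin (d + 1)) (z : SiteY i) {r : ℤ}, r ≤ R + (bS i c : ℤ) → NearC i c r z.1 →
      W κ ((B6GlobalChartV1.boxEquiv i.hN).symm z) = V κ ((B6GlobalChartV1.boxEquiv i.hN).symm z) :=
    fun κ z r hr hz => hWV κ _ (by rw [Equiv.apply_symm_apply]; exact hz.mono i c hr)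
  -- the rungs of a taxi run between two sites of the member block of a row `z ∈ D` are agreement points
  have rung : ∀ {z : SiteY i}, z ∈ D → ∀ (a e : SiteY i), blkOf (toKT i).D.toDomains a = blkOf (toKT i).D.toDomains z →
      blkOf (toKT i).D.toDomains e = blkOf (toKT i).D.toDomains z → ∀ r ∈ taxiBondsY i a e, W r.2.1 r.1 = V r.2.1 r.1 := by
    intro z hz a e ha he r hr
    have hzD := hD z hz
    have hblk : blkOf (toKT i).D.toDomains (B6GlobalChartV1.toBox i.hN r.1) = blkOf (toKT i).D.toDomains z :=
      B9Eq358TaxiLettersY.blkOf_toBox_rung_eq i (blkOf (toKT i).D.toDomains z) _ _ (fun μ => (B9Eq358TaxiLettersY.val_sub_corner i _ ha μ).2)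
        (fun μ => (B9Eq358TaxiLettersY.val_sub_corner i _ he μ).2) r hr
    have h1 := nearC_of_blkOf_eq i c hblk.symm hzD
    have hp := pow_levY_le_bS' i c hR hzD
    rw [levY_eq_of_blkOf_eq i hblk] at h1
    have h2 : NearC i c (R + (bS i c : ℤ)) (B6GlobalChartV1.toBox i.hN r.1).1 := h1.mono i c (by linarith)
    exact hWV r.2.1 r.1 (by rw [B6GlobalChartV1.boxEquiv_apply]; exact h2)
  refine ⟨fun z hz μ => ?_, fun z hz w hw => ?_⟩
  · have hzD := hD z hz
    exact ⟨key μ z (by linarith) hzD, key μ _ (by linarith) (nearC_shiftY_symm i c hzD μ)⟩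
  · have hbl : blkOf (toKT i).D.toDomains w = blkOf (toKT i).D.toDomains z := by
      rw [B9Thm311DeltaPrimeSymm.avgCoeffY_eq_ite] at hw
      by_contra hne; exact hw (if_neg hne)
    have hc : blkOf (toKT i).D.toDomains (Node00.cornerY i (levY i z) z) = blkOf (toKT i).D.toDomains z := by
      rw [B9Thm311DeltaPrimeSymm.cornerY_levY_eq]
      exact B6Geom246MultiLevelBox.blkOf_corner _ _
    exact ⟨⟨rung hz _ _ rfl hc, rung hz _ _ hc rfl⟩, ⟨rung hz _ _ hc hbl, rung hz _ _ hbl hc⟩⟩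

/-- ★ **`AgreeNearY` FOR `U^u` AND `Ṽ_□ = e^{iηχ̃_□A}` ON A ROW SET WITHIN `R`, `4(R + L^{j+1}) ≤ 15S_j`, FROM THE (3.35) DATUM**: `U^u = e^{iηA}` on every bond with both
ends in `Q ⊇` the torus points within `4.375S_j + 1`, and `χ̃_□ = 1` within `3.75S_j`. [cite: Balaban1985BackgroundPropagators, Cor. 3.6 p.408, p.410 l.14–15, p.409 l.1–3] -/
theorem agreeNearY_locCfgY_of_nearC' {W : CfgY 𝔸 i} {Q : Set (Site (B6GlobalChartV1.PV d ℓ i.m i.K hd hL) 0)} (η : ℝ) (A : B9Eq360DeltaPrimeAY.AfldY 𝔸 i)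
    (hQ : ∀ x : Site (B6GlobalChartV1.PV d ℓ i.m i.K hd hL) 0, NearC i c (35 * SC i c / 8 + 1) (B6GlobalChartV1.boxEquiv i.hN x).1 → x ∈ Q)
    (hWA : ∀ (κ : Fin (d + 1)) (x : Site (B6GlobalChartV1.PV d ℓ i.m i.K hd hL) 0), x ∈ Q → x.shift κ ∈ Q →
      W κ x = B9Eq39Adjoint.fluct η A κ x)
    {R : ℤ} (hR : R ≤ 4 * SC i c) (hR15 : 4 * (R + (bS i c : ℤ)) ≤ 15 * SC i c)
    {D : Finset (SiteY i)} (hD : ∀ z ∈ D, NearC i c R z.1) :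
    AgreeNearY i D W (locCfgY i c η A) := by
  refine agreeNearY_of_nearC' i c hR (fun κ x hx => ?_) hD
  have hS := nine_le_SC i c
  have h1 : chiTY i c (B6GlobalChartV1.boxEquiv i.hN x) = 1 := chiTY_eq_one_of_nearC i c hR15 hx
  rw [locCfgY_apply, fluct_cutFldY_of_eq_one i η A h1]
  refine hWA κ x (hQ x (hx.mono i c (by omega))) (hQ _ ?_)
  have e : B6GlobalChartV1.boxEquiv i.hN (x.shift κ) = shiftY i κ (B6GlobalChartV1.boxEquiv i.hN x) := by
    apply (B6GlobalChartV1.boxEquiv i.hN).symm.injective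
    rw [Node00.boxEquiv_symm_shiftY, Equiv.symm_apply_apply, Equiv.symm_apply_apply]
  rw [e]
  exact (nearC_shiftY i c hx κ).mono i c (by omega)

/-! ## §4 The two row laws of file D1 and the plateau relations, at the (3.35) datum with `φ := χ_□`, `parS := parSymY` -/

/-- ★★ **ROW LAW 1: `Δ′_a(U^u)·M_χ = Δ′_{a,□}(Ṽ_□)·M_χ`** — a row of either side vanishes unless its stencil meets `supp χ_□` (`z ∈ D_χ`); on `D_χ` the member's
operator at `U^u` and at `Ṽ_□` agree (bond agreement out to `3.75S_j`, local transporters) and the member's operator at `Ṽ_□` IS the cube's (`D_χ ⊂ NearH`).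
[cite: Balaban1985BackgroundPropagators, (3.24) p.394, Cor. 3.6 p.408, p.410 l.14–15, (3.88) p.409] -/
theorem deltaPrimeAY_gauge_mul_cutMulY_chiY (g : GaugeY 𝔸 i) (U : CfgY 𝔸 i) {Q : Set (Site (B6GlobalChartV1.PV d ℓ i.m i.K hd hL) 0)} (η : ℝ)
    (A : B9Eq360DeltaPrimeAY.AfldY 𝔸 i)
    (hQ : ∀ x : Site (B6GlobalChartV1.PV d ℓ i.m i.K hd hL) 0, NearC i c (35 * SC i c / 8 + 1) (B6GlobalChartV1.boxEquiv i.hN x).1 → x ∈ Q)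
    (hgA : ∀ (κ : Fin (d + 1)) (x : Site (B6GlobalChartV1.PV d ℓ i.m i.K hd hL) 0), x ∈ Q → x.shift κ ∈ Q →
      gaugeY i g U κ x = B9Eq39Adjoint.fluct η A κ x) :
    deltaPrimeAY i (parSymY i) (gaugeY i g U) * cutMulY (chiY i c) = deltaPrimeACubeY i c (parSymY i) (locCfgY i c η A) * cutMulY (chiY i c) := by
  classical
  have h8 := eight_mul_bS_le_SC i c
  have hS := nine_le_SC i c
  have hagree : AgreeNearY i (Dchi i c) (gaugeY i g U) (locCfgY i c η A) :=
    agreeNearY_locCfgY_of_nearC' i c η A hQ hgA (R := 7 * SC i c / 2 + (bS i c : ℤ)) (by omega) (by omega) fun z hz => nearC_of_mem_Dchi i c hz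
  refine LinearMap.ext fun Λ => funext fun z => ?_
  rw [Module.End.mul_apply, Module.End.mul_apply]
  by_cases hz : z ∈ Dchi i c
  · rw [deltaPrimeAY_apply_congr_of_parLocalY (parLocalY_parSymY i) hagree _ hz,
      deltaPrimeACubeY_apply_eq_of_nearH i c (parSymY i) _ _ (nearH_of_mem_Dchi i c hz)]
  · have h0 : ∀ w ∈ stencilY i z, cutMulY (chiY i c) Λ w = 0 := fun w hw => by
      rw [cutMulY_apply, chiY_eq_zero_of_not_mem_Dchi i c hz w hw, Complex.ofReal_zero, zero_smul]
    rw [deltaPrimeAY_apply_eq_zero_of_stencil i (parSymY i) _ z h0, deltaPrimeACubeY_apply_eq_zero_of_stencil i c (parSymY i) _ z h0]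

/-- ★★ **ROW LAW 2: `M_χ·Δ′_{a,□}(Ṽ) − Δ′_{a,□}(Ṽ)·M_χ = K(χ_□)(Ṽ)`** (p38's `KhY` at the MEMBER's `Δ′_a(Ṽ)`): near □ the cube's rows are the member's, and off `NearH`
both sides vanish (`χ_□ = 0` on the whole stencil). [cite: Balaban1985BackgroundPropagators, (3.88) p.409, p.408 l.36–44, p.409 l.1–5] -/
theorem comm_cutMulY_chiY_deltaPrimeACubeY (V : CfgY 𝔸 i) :
    cutMulY (chiY i c) * deltaPrimeACubeY i c (parSymY i) V - deltaPrimeACubeY i c (parSymY i) V * cutMulY (chiY i c) = KhY i (parSymY i) (chiY i c) V := by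
  classical
  refine LinearMap.ext fun Λ => funext fun z => ?_
  rw [B9Thm37CubeCoverCommutators.KhY_def, B9Thm37CubeCoverCommutators.cutCommY_apply, LinearMap.sub_apply, Pi.sub_apply, Module.End.mul_apply,
    Module.End.mul_apply, cutMulY_apply]
  by_cases hz : NearH c z.1
  · rw [deltaPrimeACubeY_apply_eq_of_nearH i c (parSymY i) V Λ hz, deltaPrimeACubeY_apply_eq_of_nearH i c (parSymY i) V _ hz]
  · have hz' : z ∉ Dchi i c := fun h => hz (nearH_of_mem_Dchi i c h)
    have h0 : ∀ w ∈ stencilY i z, cutMulY (chiY i c) Λ w = 0 := fun w hw => by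
      rw [cutMulY_apply, chiY_eq_zero_of_not_mem_Dchi i c hz' w hw, Complex.ofReal_zero, zero_smul]
    have hχz : chiY i c z = 0 := chiY_eq_zero_of_not_mem_Dchi i c hz' z (B9Thm37CubeCoverCommutators.self_mem_stencilY i z)
    rw [deltaPrimeACubeY_apply_eq_zero_of_stencil i c (parSymY i) V z h0, deltaPrimeAY_apply_eq_zero_of_stencil i (parSymY i) V z h0, hχz,
      Complex.ofReal_zero, zero_smul, zero_smul]

end Agreement

/-- ★ **PLATEAU RELATION `χ̃_□·χ_□ = χ̃_□` ON SITES** (`χ_□ = 1` on `□̃`). [cite: Balaban1985BackgroundPropagators, (3.95) p.411, Cor. 3.6 p.408] -/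
theorem chiBigT_site_mul_chiY (z : SiteY i) : chiBigT i c (blkOf i.D.toDomains z) * chiY i c z = chiBigT i c (blkOf i.D.toDomains z) := by
  unfold chiBigT
  by_cases ht : blkOf i.D.toDomains z ∈ QbigT i.D (one_le_Mh i) (four_le_P' i) c
  · rw [if_pos ht, chiY_eq_one_of_mem_QbigT i c ht rfl, mul_one]
  · rw [if_neg ht, zero_mul]

/-- ★ **PLATEAU RELATION `χ_□·1_{□⁺} = 1_{□⁺}` ON SITES** (`χ_□ = 1` on `□⁺ ⊂ □̃`). [cite: Balaban1985BackgroundPropagators, (3.95) p.411; Balaban1984PropagatorsII, p.239] -/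
theorem chiY_mul_cubeIndT_site (z : SiteY i) :
    chiY i c z * cubeIndT i.D (one_le_Mh i) (four_le_P' i) c (blkOf i.D.toDomains z) = cubeIndT i.D (one_le_Mh i) (four_le_P' i) c (blkOf i.D.toDomains z) := by
  unfold cubeIndT
  by_cases ht : blkOf i.D.toDomains z ∈ QT i.D (one_le_Mh i) (four_le_P' i) c
  · rw [if_pos ht, chiY_eq_one_of_mem_QT i c ht rfl, one_mul]
  · rw [if_neg ht, mul_zero]

end Literature.MathematicalPhysics.QuantumFieldTheory.Balaban1983to89.B9ThmDCubePlateau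

end
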